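import Summits.BirchSwinnertonDyer.Rank1Residual.GaloisImage.KolyvaginPrimeCyclicityTransfer
import Summits.BirchSwinnertonDyer.Rank1Residual.GaloisImage.KolyvaginPrimeTorsionCount
import Summits.BirchSwinnertonDyer.Rank1Residual.GaloisImage.ReductionTorsionFlag
import Literature.NumberTheory.EllipticCurves.KatoKolyvaginPrimes
import HarnessLib

/-!
# The model transfer `Ẽ_v(k_v) ≃+ (E₀ mod ℓ)(ℤ/ℓ)` as a GROUP ISOMORPHISM, equality of torsion
# counts (adapter (M) of the R1-23 hand-over), and the EXACT level-one count `#Ẽ_v(k_v)[p] = p`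
# at a Kolyvagin prime with `p² ∤ #Ẽ(𝔽_ℓ)` (row T-B1 sequel; cell `b2b-bsdres`, team n1011,
# seat p09 GEN 5)

HONEST FRAMING (cell `b2b-bsdres`, run/shared/lean/b2b/bsd-rank1-residual/, verbatim in every
file): the goal of the cell is to DELETE the COMBINATION-SHAPED residual classes of the
Birch–Swinnerton-Dyer formula for ALL analytic-rank `≤ 1` elliptic curves over `ℚ` — "full BSD
formula for every rank `≤ 1` curve in class `C`" assembled STRICTLY from published theorems — so
that the rank-`≤ 1` remainder becomes exactly the CONSTRUCTION-SHAPED classes, which are TYPED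
(missing-input `Prop`s), NOT attempted. This is not "finishing BSD". Team n1011 (N10/N11, the
additive block `X4 ∧ p = 3`): research route; TOOL theorems only (no definition, no named fact);
nothing here is a class theorem, no label changes, nothing is booked, no mark moves.

## What and why

The membership theorem of bridge (B1) (`FrobShape.mem_frobeniusClassPrimes_of_kolyvaginPrime`,
p18) and the R1-23 END theorem in Kim's ℕ-currency (`Assembly.padicValRat_le_of_kolyvaginProduct`)
take, at every Kolyvagin prime `ℓ` of the certificate, the CYCLICITY FLAG
`hflag : Nat.card (AddSubgroup.torsionBy (W.reductionAt v).toAffine.Point p) ≤ p` on the reduction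
`Ẽ_v / k_v` of the LOCAL minimal model at the place `v ∣ ℓ`.  Two suppliers are in the tree:
`KolyvaginPrimeCyclicityTransfer` (FILE 3 of row T-B1, p09: from the records' currency
`#(E₀ mod ℓ)(𝔽_ℓ)[p] ≤ p` through an INJECTIVE additive map `Ẽ_v(k_v) →+ (E₀ mod ℓ)(ℤ/ℓ)`, every
level) and `ReductionTorsionFlag` (ROUTE-1 R1-50, p11: at level one from the bare count
`p² ∤ #Ẽ(𝔽_ℓ)`).  This file adds:

* **Adapter (M) (equality).**  The injective map of FILE 3 is BIJECTIVE (equal finite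
  cardinalities, Silverman VII.1.3(b) = the tree's `natCard_point_reduction_minimal_baseChange`),
  hence a group isomorphism `Ẽ_v(k_v) ≃+ (E₀ mod ℓ)(ℤ/ℓ)` (`nonempty_addEquiv_reductionAt_intModel`);
  consequently the `n`-torsion counts agree for EVERY `n` (`natCard_torsionBy_reductionAt_eq`,
  both place spellings), which is the literal equality `#Ẽ_v(k_v)[3] = #{P ∈ (E₀ mod ℓ)(𝔽_ℓ) : 3P = 0}`
  asked for by the R1-23 hand-over (`HOME/b2b-bsdres-n1011-p18/README.md`, "OPEN adapters (M)");
* **exact counts at a flagged Kolyvagin prime**: `#Ẽ_v(k_v)[p^K] = p^K` from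
  `Kato.IsKolyvaginPrime W p K ℓ` and the records' currency (`…_pow_eq_of_isKolyvaginPrime`, via
  p18's `FrobShape.natCard_torsionBy_pow_eq`) or from the flag itself
  (`…_pow_eq_of_isKolyvaginPrime_of_flag`), and at LEVEL ONE `#Ẽ_v(k_v)[p] = p` from
  `Kato.IsKolyvaginPrime W p 1 ℓ` and `p² ∤ #Ẽ(𝔽_ℓ)` (`…_eq_of_isKolyvaginPrime_one`, the flag being
  p11's R1-50 `FrobShape.natCard_torsionBy_reductionAt_le_of_not_sq_dvd` BY NAME; `_of_flag` form for any
  other supplier) — the `p`-part of `Ẽ(𝔽_ℓ)` is then exactly `ℤ/p`;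
* **spelling adapters** for per-prime assembly: R1-50 in the `primesEquiv v = ℓ` spelling
  (`natCard_torsionBy_reductionAt_le_of_not_sq_dvd_of_primesEquiv_eq`), FILE 3's supplier with the place spelled
  `(ℓ : 𝓞 ℚ) ∈ v.asIdeal` (p18's binder shape; `natCard_torsionBy_reductionAt_le_of_card_torsion_le'`),
  `#Ẽ_v(k_v) = W.reductionPointCount ℓ` and finiteness of `Ẽ_v(k_v)` in the place spelling
  `W.reductionAt v`, the `{a // n • a = 0}` ↔ `AddSubgroup.torsionBy` and `AddEquiv` transports of
  torsion counts.

Not re-proved here (cell rule, one statement each): the level-one flag itself (p11's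
`FrobShape.natCard_torsionBy_reductionAt_le_of_not_sq_dvd`) and the records'-currency count
`#{P ∈ (E₀ mod ℓ)(𝔽_ℓ) : pP = 0} ≤ p ⟸ p² ∤ n_ℓ` (p03's `Additive.card_torsion_le_of_intModel_of_card`).

References: J. H. Silverman, *AEC* 2nd ed. (2009) Prop. VII.1.3(b) p. 186, V.§1
[SilvermanAEC2009]; C.-H. Kim, AJM 148 (2026) §1.2.2 (`𝒫_k`, cyclicity of `Ẽ(𝔽_ℓ)[p^∞]`)
[Kim2022StructureSelmer]; cell files ROUTE-1 §29.2 / §29.5, `HOME/b2b-bsdres-n1011-p18/README.md` (M).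
-/

noncomputable section

open scoped Classical
open NumberField IsDedekindDomain IsDedekindDomain.HeightOneSpectrum Field WeierstrassCurve
  Literature.NumberTheory.EllipticCurves Literature.NumberTheory.GaloisRepresentations
  Rat.HeightOneSpectrum

namespace Summit.BirchSwinnertonDyer.Rank1Residual.GaloisImage.KolyvaginPrime

/-! ## §1 Finite abelian groups: transports of torsion counts -/

section Group

variable {A : Type*} [AddCommGroup A]

open AddSubgroup in
/-- Transport of `n`-torsion counts along a group isomorphism. [folklore] -/
theorem natCard_torsionBy_congr {B : Type*} [AddCommGroup B] (e : A ≃+ B) (n : ℕ) :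
    Nat.card (torsionBy A n) = Nat.card (torsionBy B n) := by
  refine Nat.card_congr ⟨fun x ↦ ⟨e x.1, ?_⟩, fun y ↦ ⟨e.symm y.1, ?_⟩, fun x ↦ ?_, fun y ↦ ?_⟩
  · exact torsionBy.nsmul_iff.mpr (by rw [← map_nsmul, torsionBy.nsmul_iff.mp x.2, map_zero])
  · exact torsionBy.nsmul_iff.mpr (by rw [← map_nsmul, torsionBy.nsmul_iff.mp y.2, map_zero])
  · exact Subtype.ext (e.symm_apply_apply x.1)
  · exact Subtype.ext (e.apply_symm_apply y.1)

open AddSubgroup in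
/-- The subtype spelling `{a // n • a = 0}` of the records and `AddSubgroup.torsionBy A n` have the
same cardinality. [folklore] -/
theorem natCard_subtype_nsmul_eq_zero_eq (n : ℕ) :
    Nat.card {a : A // n • a = 0} = Nat.card (torsionBy A n) :=
  Nat.card_congr ⟨fun x ↦ ⟨x.1, torsionBy.nsmul_iff.mpr x.2⟩, fun y ↦ ⟨y.1, torsionBy.nsmul_iff.mp y.2⟩,
    fun _ ↦ rfl, fun _ ↦ rfl⟩

end Group

/-! ## §2 `Ẽ_v(k_v)`: finiteness and `#Ẽ_v(k_v) = #Ẽ(𝔽_ℓ)` in the place spelling `W.reductionAt v` -/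

universe u

/-- `(E₀ mod ℓ)(ℤ/ℓ)` is finite (`ℤ/ℓ` finite, `ℓ` prime; the tree's `finite_point`).  A theorem,
not an instance: consumers write `haveI := finite_point_intModel_map W ℓ`. [folklore] -/
theorem finite_point_intModel_map (W : WeierstrassCurve ℚ) [W.IsGloballyMinimal] (ℓ : ℕ)
    [Fact ℓ.Prime] : Finite ((integralModelInt W).map (Int.castRingHom (ZMod ℓ))).toAffine.Point :=
  WeierstrassCurve.finite_point _

/-- `Ẽ_v(k_v)` is finite: it injects into `(E₀ mod ℓ)(ℤ/ℓ)`
(`exists_addMonoidHom_reductionAt_intModel_injective`). [folklore] -/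
theorem finite_point_reductionAt (W : WeierstrassCurve ℚ) [W.IsElliptic] [W.IsGloballyMinimal]
    {ℓ : ℕ} [Fact ℓ.Prime] {v : HeightOneSpectrum (𝓞 ℚ)} (hv : (primesEquiv v : ℕ) = ℓ) :
    Finite (W.reductionAt v).toAffine.Point := by
  haveI := finite_point_intModel_map W ℓ
  obtain ⟨T, hT⟩ := exists_addMonoidHom_reductionAt_intModel_injective W (ℓ := ℓ) hv
  exact Finite.of_injective T hT

/-- **`#Ẽ_v(k_v) = #Ẽ(𝔽_ℓ)`** in the place spelling `W.reductionAt v` (`v ∣ ℓ`, `W` globally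
minimal): the tree's `natCard_point_reduction_minimal_baseChange` (Silverman VII.1.3(b)).
[cite: SilvermanAEC2009, Prop. VII.1.3(b), p. 186] -/
theorem natCard_point_reductionAt_eq_reductionPointCount (W : WeierstrassCurve ℚ) [W.IsElliptic]
    [W.IsGloballyMinimal] {ℓ : ℕ} {v : HeightOneSpectrum (𝓞 ℚ)} (hv : (primesEquiv v : ℕ) = ℓ) :
    Nat.card (W.reductionAt v).toAffine.Point = W.reductionPointCount ℓ := by
  rw [← hv]
  exact natCard_point_reduction_minimal_baseChange v W

/-- Place spellings: `primesEquiv v = ℓ ⟹ (ℓ : 𝓞 ℚ) ∈ v.asIdeal` (converse of the tree's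
`primesEquiv_eq_of_natCast_mem`; Mathlib `natGenerator_dvd_iff`). [folklore] -/
theorem natCast_mem_asIdeal_of_primesEquiv_eq {v : HeightOneSpectrum (𝓞 ℚ)} {ℓ : ℕ}
    (hv : (primesEquiv v : ℕ) = ℓ) : (ℓ : 𝓞 ℚ) ∈ v.asIdeal := by
  have h : Rat.HeightOneSpectrum.natGenerator v ∣ ℓ := by
    rw [← hv]
    exact dvd_rfl
  rw [Rat.HeightOneSpectrum.natGenerator_dvd_iff, Ideal.mem_map_of_equiv] at h
  obtain ⟨x, hx, hxe⟩ := h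
  have hxℓ : x = (ℓ : 𝓞 ℚ) := (Rat.IsIntegralClosure.intEquiv (𝓞 ℚ)).injective
    (by rw [hxe, map_natCast])
  rwa [hxℓ] at hx

/-! ## §3 Spelling adapters for per-prime assembly

The level-one flag `p² ∤ #Ẽ(𝔽_ℓ) ⟹ #Ẽ_v(k_v)[p] ≤ p` (ROUTE-1 R1-50) is p11's
`FrobShape.natCard_torsionBy_reductionAt_le_of_not_sq_dvd` (`GaloisImage/ReductionTorsionFlag`,
imported and used BY NAME — lead R5-60); here only its `primesEquiv` place spelling, and the `_of_flag`
theorems of §4 take any flag supplier as the input `hflag`. -/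

/-- **R1-50 in the `primesEquiv v = ℓ` place spelling** (FILE 3's spelling): p11's
`FrobShape.natCard_torsionBy_reductionAt_le_of_not_sq_dvd` BY NAME through
`natCast_mem_asIdeal_of_primesEquiv_eq`. [cite: SilvermanAEC2009, Prop. VII.1.3(b), p. 186] -/
theorem natCard_torsionBy_reductionAt_le_of_not_sq_dvd_of_primesEquiv_eq (W : WeierstrassCurve ℚ)
    [W.IsElliptic] [W.IsGloballyMinimal] (p : ℕ) [Fact p.Prime] {ℓ : ℕ} [Fact ℓ.Prime]
    {v : HeightOneSpectrum (𝓞 ℚ)} (hv : (primesEquiv v : ℕ) = ℓ)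
    (h : ¬ p ^ 2 ∣ W.reductionPointCount ℓ) :
    Nat.card (AddSubgroup.torsionBy (W.reductionAt v).toAffine.Point (p : ℕ)) ≤ p :=
  FrobShape.natCard_torsionBy_reductionAt_le_of_not_sq_dvd W p ℓ
    (natCast_mem_asIdeal_of_primesEquiv_eq hv) h

/-- FILE 3's flag supplier `natCard_torsionBy_reductionAt_le_of_card_torsion_le` (records' currency
`#(E₀ mod ℓ)(𝔽_ℓ)[p] ≤ p` ⟹ `hflag`, EVERY level) with the place spelled `(ℓ : 𝓞 ℚ) ∈ v.asIdeal` — the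
binder shape of `FrobShape.mem_frobeniusClassPrimes_of_kolyvaginPrime` — so that a per-prime assembly
passes `hv` through unchanged. [cite: SilvermanAEC2009, Prop. VII.1.3(b), p. 186] -/
theorem natCard_torsionBy_reductionAt_le_of_card_torsion_le' (W : WeierstrassCurve ℚ) [W.IsElliptic]
    [W.IsGloballyMinimal] (p : ℕ) {ℓ : ℕ} [hℓ : Fact ℓ.Prime] {v : HeightOneSpectrum (𝓞 ℚ)}
    (hv : (ℓ : 𝓞 ℚ) ∈ v.asIdeal)
    (hcyc : Nat.card {P : ((integralModelInt W).map (Int.castRingHom (ZMod ℓ))).toAffine.Point //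
      p • P = 0} ≤ p) :
    Nat.card (AddSubgroup.torsionBy (W.reductionAt v).toAffine.Point (p : ℕ)) ≤ p :=
  natCard_torsionBy_reductionAt_le_of_card_torsion_le W p (primesEquiv_eq_of_natCast_mem hℓ.out hv)
    hcyc

/-! ## §4 Adapter (M): `Ẽ_v(k_v) ≃+ (E₀ mod ℓ)(ℤ/ℓ)` and equality of torsion counts -/

/-- **Adapter (M) — the model transfer as a GROUP ISOMORPHISM.**  For `W/ℚ` globally minimal
elliptic and `v ∣ ℓ`: `Ẽ_v(k_v) ≃+ (E₀ mod ℓ)(ℤ/ℓ)`, `E₀ = integralModelInt W`.  The injective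
additive map of `exists_addMonoidHom_reductionAt_intModel_injective` (base change along
`k_v ≃+* ℤ/ℓ`, then the reduced `𝓞_v`-integral change of variables between the two minimal models,
Silverman VII.1.3(b)) is bijective because source and target are finite of the same cardinality
`#Ẽ(𝔽_ℓ)` (`natCard_point_reduction_minimal_baseChange`). [cite: SilvermanAEC2009, Prop. VII.1.3(b), p. 186] -/
theorem nonempty_addEquiv_reductionAt_intModel (W : WeierstrassCurve ℚ) [W.IsElliptic]
    [W.IsGloballyMinimal] {ℓ : ℕ} [Fact ℓ.Prime] {v : HeightOneSpectrum (𝓞 ℚ)}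
    (hv : (primesEquiv v : ℕ) = ℓ) :
    Nonempty ((W.reductionAt v).toAffine.Point ≃+
      ((integralModelInt W).map (Int.castRingHom (ZMod ℓ))).toAffine.Point) := by
  haveI := finite_point_intModel_map W ℓ
  obtain ⟨T, hT⟩ := exists_addMonoidHom_reductionAt_intModel_injective W (ℓ := ℓ) hv
  have hcard : Nat.card ((integralModelInt W).map (Int.castRingHom (ZMod ℓ))).toAffine.Point ≤
      Nat.card (W.reductionAt v).toAffine.Point := by
    rw [natCard_point_reductionAt_eq_reductionPointCount W hv]
    rfl
  exact ⟨AddEquiv.ofBijective T (hT.bijective_of_nat_card_le hcard)⟩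

/-- **Adapter (M) — equality of `n`-torsion counts for every `n`**:
`#Ẽ_v(k_v)[n] = #{P ∈ (E₀ mod ℓ)(ℤ/ℓ) : n • P = 0}` (the literal shape of the R1-23 hand-over,
p18 README (M), at `n = 3`; also at `n = p^K`). [cite: SilvermanAEC2009, Prop. VII.1.3(b), p. 186] -/
theorem natCard_torsionBy_reductionAt_eq (W : WeierstrassCurve ℚ) [W.IsElliptic]
    [W.IsGloballyMinimal] {ℓ : ℕ} [Fact ℓ.Prime] {v : HeightOneSpectrum (𝓞 ℚ)}
    (hv : (primesEquiv v : ℕ) = ℓ) (n : ℕ) :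
    Nat.card (AddSubgroup.torsionBy (W.reductionAt v).toAffine.Point n) =
      Nat.card {P : ((integralModelInt W).map (Int.castRingHom (ZMod ℓ))).toAffine.Point //
        n • P = 0} := by
  obtain ⟨e⟩ := nonempty_addEquiv_reductionAt_intModel W (ℓ := ℓ) hv
  rw [natCard_subtype_nsmul_eq_zero_eq, natCard_torsionBy_congr e n]

/-- (M) with the place spelled `(ℓ : 𝓞 ℚ) ∈ v.asIdeal`. [cite: SilvermanAEC2009, Prop. VII.1.3(b), p. 186] -/
theorem natCard_torsionBy_reductionAt_eq' (W : WeierstrassCurve ℚ) [W.IsElliptic]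
    [W.IsGloballyMinimal] {ℓ : ℕ} [hℓ : Fact ℓ.Prime] {v : HeightOneSpectrum (𝓞 ℚ)}
    (hv : (ℓ : 𝓞 ℚ) ∈ v.asIdeal) (n : ℕ) :
    Nat.card (AddSubgroup.torsionBy (W.reductionAt v).toAffine.Point n) =
      Nat.card {P : ((integralModelInt W).map (Int.castRingHom (ZMod ℓ))).toAffine.Point //
        n • P = 0} :=
  natCard_torsionBy_reductionAt_eq W (primesEquiv_eq_of_natCast_mem hℓ.out hv) n

/-- **`#Ẽ_v(k_v)[p^K] = p^K` at a flagged Kolyvagin prime of level `K`**: from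
`hK : Kato.IsKolyvaginPrime W p K ℓ` (`p^K ∣ #Ẽ(𝔽_ℓ)`, `IsKolyvaginPrime.pow_dvd_reductionPointCount`)
and the records' cyclicity currency `#(E₀ mod ℓ)(𝔽_ℓ)[p] ≤ p`, by p18's
`FrobShape.natCard_torsionBy_pow_eq` on the finite group `Ẽ_v(k_v)` of order `#Ẽ(𝔽_ℓ)`.
(Kim, §1.2.2: at `ℓ ∈ 𝒫_K` the `p`-part of `Ẽ(𝔽_ℓ)` is cyclic of order divisible by `p^K`.)
[cite: Kim2022StructureSelmer, §1.2.2] -/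
theorem natCard_torsionBy_reductionAt_pow_eq_of_isKolyvaginPrime (W : WeierstrassCurve ℚ)
    [W.IsElliptic] [W.IsGloballyMinimal] {p K ℓ : ℕ} [Fact p.Prime] [Fact ℓ.Prime]
    (hK : Kato.IsKolyvaginPrime W p K ℓ) {v : HeightOneSpectrum (𝓞 ℚ)}
    (hv : (primesEquiv v : ℕ) = ℓ)
    (hcyc : Nat.card {P : ((integralModelInt W).map (Int.castRingHom (ZMod ℓ))).toAffine.Point //
      p • P = 0} ≤ p) :
    Nat.card (AddSubgroup.torsionBy (W.reductionAt v).toAffine.Point (p ^ K : ℕ)) = p ^ K := by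
  haveI := finite_point_reductionAt W hv
  have h1 := natCard_torsionBy_reductionAt_le_of_card_torsion_le W p hv hcyc
  have hdvd : p ^ K ∣ Nat.card (W.reductionAt v).toAffine.Point := by
    rw [natCard_point_reductionAt_eq_reductionPointCount W hv]
    exact hK.pow_dvd_reductionPointCount
  exact FrobShape.natCard_torsionBy_pow_eq h1 hdvd

/-- **`#Ẽ_v(k_v)[p^K] = p^K` at a flagged Kolyvagin prime of level `K`, FLAG CURRENCY**: from
`hK : Kato.IsKolyvaginPrime W p K ℓ` (`p^K ∣ #Ẽ(𝔽_ℓ)`) and the flag `#Ẽ_v(k_v)[p] ≤ p` itself (p18's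
binder `hflag`; suppliers: FILE 3 at every level, p11's R1-50
`FrobShape.natCard_torsionBy_reductionAt_le_of_not_sq_dvd` at level one), by p18's
`FrobShape.natCard_torsionBy_pow_eq` on the finite group `Ẽ_v(k_v)` of order `#Ẽ(𝔽_ℓ)`.
[cite: Kim2022StructureSelmer, §1.2.2] -/
theorem natCard_torsionBy_reductionAt_pow_eq_of_isKolyvaginPrime_of_flag (W : WeierstrassCurve ℚ)
    [W.IsElliptic] [W.IsGloballyMinimal] {p K ℓ : ℕ} [Fact p.Prime]
    (hK : Kato.IsKolyvaginPrime W p K ℓ) {v : HeightOneSpectrum (𝓞 ℚ)}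
    (hv : (ℓ : 𝓞 ℚ) ∈ v.asIdeal)
    (hflag : Nat.card (AddSubgroup.torsionBy (W.reductionAt v).toAffine.Point (p : ℕ)) ≤ p) :
    Nat.card (AddSubgroup.torsionBy (W.reductionAt v).toAffine.Point (p ^ K : ℕ)) = p ^ K := by
  haveI := Fact.mk hK.prime
  have hvℓ : (primesEquiv v : ℕ) = ℓ := primesEquiv_eq_of_natCast_mem hK.prime hv
  haveI := finite_point_reductionAt W hvℓ
  have hdvd : p ^ K ∣ Nat.card (W.reductionAt v).toAffine.Point := by
    rw [natCard_point_reductionAt_eq_reductionPointCount W hvℓ]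
    exact hK.pow_dvd_reductionPointCount
  exact FrobShape.natCard_torsionBy_pow_eq hflag hdvd

/-- **Exact level-one count**: `#Ẽ_v(k_v)[p] = p` at a Kato–Kolyvagin prime of level `1`
(`Kato.IsKolyvaginPrime W p 1 ℓ`: `ℓ ∤ Np`, `ℓ ≡ 1`, `a_ℓ ≡ 2 (mod p)`, so `p ∣ #Ẽ(𝔽_ℓ)`) carrying the
flag — so the `p`-part of `Ẽ(𝔽_ℓ)` is EXACTLY `ℤ/p` (Kim §1.2.2's cyclic reduction at `ℓ ∈ 𝒫₁`).
With `hflag := FrobShape.natCard_torsionBy_reductionAt_le_of_not_sq_dvd W p ℓ hv h`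
(`h : ¬ p² ∣ W.reductionPointCount ℓ`, p11's R1-50) this is the exact count from the two bare
numerics `p ∣ #Ẽ(𝔽_ℓ)`, `p² ∤ #Ẽ(𝔽_ℓ)`. [cite: Kim2022StructureSelmer, §1.2.2] -/
theorem natCard_torsionBy_reductionAt_eq_of_isKolyvaginPrime_one_of_flag (W : WeierstrassCurve ℚ)
    [W.IsElliptic] [W.IsGloballyMinimal] {p ℓ : ℕ} [Fact p.Prime]
    (hK : Kato.IsKolyvaginPrime W p 1 ℓ) {v : HeightOneSpectrum (𝓞 ℚ)}
    (hv : (ℓ : 𝓞 ℚ) ∈ v.asIdeal)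
    (hflag : Nat.card (AddSubgroup.torsionBy (W.reductionAt v).toAffine.Point (p : ℕ)) ≤ p) :
    Nat.card (AddSubgroup.torsionBy (W.reductionAt v).toAffine.Point (p : ℕ)) = p := by
  have := natCard_torsionBy_reductionAt_pow_eq_of_isKolyvaginPrime_of_flag W hK hv hflag
  rwa [pow_one] at this

/-- **Exact level-one count from the two bare numerics** `p ∣ #Ẽ(𝔽_ℓ)` (inside
`Kato.IsKolyvaginPrime W p 1 ℓ`) and `p² ∤ #Ẽ(𝔽_ℓ)`: `#Ẽ_v(k_v)[p] = p` — the flag is p11's R1-50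
`FrobShape.natCard_torsionBy_reductionAt_le_of_not_sq_dvd` BY NAME. [cite: Kim2022StructureSelmer, §1.2.2] -/
theorem natCard_torsionBy_reductionAt_eq_of_isKolyvaginPrime_one (W : WeierstrassCurve ℚ)
    [W.IsElliptic] [W.IsGloballyMinimal] {p ℓ : ℕ} [Fact p.Prime]
    (hK : Kato.IsKolyvaginPrime W p 1 ℓ) {v : HeightOneSpectrum (𝓞 ℚ)}
    (hv : (ℓ : 𝓞 ℚ) ∈ v.asIdeal) (h : ¬ p ^ 2 ∣ W.reductionPointCount ℓ) :
    Nat.card (AddSubgroup.torsionBy (W.reductionAt v).toAffine.Point (p : ℕ)) = p := by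
  haveI := Fact.mk hK.prime
  exact natCard_torsionBy_reductionAt_eq_of_isKolyvaginPrime_one_of_flag W hK hv
    (FrobShape.natCard_torsionBy_reductionAt_le_of_not_sq_dvd W p ℓ hv h)

end Summit.BirchSwinnertonDyer.Rank1Residual.GaloisImage.KolyvaginPrime

end
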